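import Summits.QuantumFields.YangMills.Theorems.BalabanUVNodesN15TwoGridOutputSwap
import Summits.QuantumFields.YangMills.Theorems.BalabanUVNodesN15TwoGridAveraging
import HarnessLib

/-!
# Route «BalabanUVNodes», node N15 = NE2, -a lane, part 45: DOOR (iv) — THE AVERAGING PART `C_Q = Q′*Q′P̂₂ − PQ*Q` OF THE TWO-GRID CONSISTENCY
# OPERATOR OF BAŁABAN's `Δ_a`, SANDWICHED `G′∘C_Q∘G`, IS `O(η)` AS A BLOCK MAJORANT (`C·(L^k)⁻¹·e^{−δ|y−y′|_T}`), HYPOTHESIS-FREE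

Cell `pub-ymgap`, seat `pub-ymgap-dag-n15-a` (KNIT-BY-NAME, g12); `--supports stmt-QuantumFields-20290 --as helper`; `HOME/pub-ymgap-dag-n15-a/DOOR-IV-PLAN.md` §7.2
(route R, split (A): `G′P − PG = idef P P̂₂ G′ G + (P̂₂ − P)G`, `idef P P̂₂ G′ G = −G′(Δ′_aP̂₂ − PΔ_a)G`, `Δ_a = Δ − ∂Π∂* + aQ*Q`).  Of the consistency operator
`Δ′_aP̂₂ − PΔ_a = (Δ′P̂₂ − PΔ) − (V′P̂₂ − PV) + a·(Q′*Q′P̂₂ − PQ*Q)` parts 43∕44 typed the Laplacian terms and the output swap; THIS FILE types the AVERAGING term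
`C_Q := Q′*∘Q′∘P̂₂ − P∘Q*∘Q` (the factor `a` is a scalar for part 46), over part 37 (`qsOp`, `qvRe`, `qvAdjRe`, `qvRe_pull_sub_apply`, `sum_lineWeight`), part 20
(`lineWeight`, `tdistT_le_one_of_lineWeight_ne_zero`, `abs_lineWeight_pair_sub_le`), part 40 (`hasMaj_sA_comp`, `hasMaj_finsum`, `hasMaj_smul_ofBlocks`), part 42
(`hasMaj_gOp_of_ineq`, `hasMaj_grad_of_ineq`, `ineq110_114_pair`), part 44 (`sA_sub_one`, `hasMaj_shiftPull_sub`, `hasMaj_outputSwap_core`) and lit-balaban's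
`B11SectG.hasMaj_comp_exp` on n15-c's unit-torus carrier (`rowSum_unitTorusGeo`, `triangle254_unitTorusGeo`).
THE ESTIMATE.  `C_Q = Q′*Q′(P̂₂ − P) + Q′*(Q′P − Q) + (Q′* − PQ*)Q` (three telescoping pieces, §37 `cQ_split_apply`).  (1) `(P̂₂ − P)G` is `O(η)` blockwise (part 44), and
`Q′`, `Q′*` keep exponential block majorants up to `e^{ρ}` each (§36: `Q = Q^s∘ρ(a_κ(n))` is an average of shifts by `< n` fine steps = less than one unit; `Q*` is the
two-block line-weight stencil).  (2) `(Q′P − Q)u (y,κ) = Q′^s[(ρ′(a′_κ(L^m)) − 1)P ρ(a_κ(L^k))u](y,κ)` EXACTLY (part 37), `a′_κ(L^m) − 1 = L^{−m}Σ_j(s_κ^j − 1)` (part 44), and each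
`(ρ′(s_κ^j)P − P)ρ(a_κ)G` is dominated blockwise by `η∇_κG` (part 44 `hasMaj_shiftPull_sub`) — (1.110) entry «∇GJ» of the coarse member: `O(η)`.  (3) the fine and coarse
stencils weight the SAME two unit blocks with weights differing by `≤ 1∕L^k` (part 20 `abs_lineWeight_pair_sub_le`): `O(η)` against entry «GJ».  Each piece is then
composed on the left with `G′` ((1.110) entry «GJ» of the fine member) by `hasMaj_comp_exp` (`ρ = σ = δ₀∕2`).  ★★ **`hasMaj_averagingDefect`**: `∃ δ C > 0 ∀ m_T k ≥ 1 m`,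
`HasMaj (ofBlocks … blkFine) (ofBlocks … blockOf_{n′}) (G′∘(Q′*∘Q′∘P̂₂ − P∘Q*∘Q)∘G) (C·(L^k)⁻¹·e^{−δ tdistT})`, core `hasMaj_averagingDefect_core` with explicit constants.
CONTENTS.  §36 block-majorant transfer through the averaging operators (`abs_qsOp_apply_le`, `hasMaj_qvRe_comp`, `hasMaj_qvAdjRe_comp`, ★ `hasMaj_qvAdjRe_sub_pull_comp`,
★ `hasMaj_qvRe_pull_sub_comp`); §37 `cQ_split_apply`, `hasMaj_averagingDefect_core`, ★★ `hasMaj_averagingDefect`.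
HONEST FRAMING ∕ LIMITS.  One more term of door (iv) entry 0; still NOT the Landau term `C_V = V′P̂₂ − PV`, `V = ∂Π∂*` (plan §7.4(a): NOT in printed currency — the located hard core),
nor the `idef_inv` bookkeeping to `NE2ZeroOperator` (part 46); constants crude and ours; Bałaban's inequality enters only through the tree's theorem `prop12_famG_printed`;
tori of record `M_μ = 2L^{m_T}`; `U ≡ 1`; count-neutral (typed 28∕28 · discharged 5∕28 unchanged); NOT a discharge of N15 (object-bound; NE2⁺ NOT PRINTED); one finite T⁴ at fixed
ε — NOT infinite volume, NOT OS on ℝ⁴, NOT a mass gap, NOT Clay.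
-/

noncomputable section

open scoped BigOperators Matrix
open Finset

namespace Summit.QuantumFields.YangMills.BalabanUVNodes.N15.TwoGrid

open Literature.MathematicalPhysics.QuantumFieldTheory.Balaban1983to89
open Literature.MathematicalPhysics.QuantumFieldTheory.Balaban1983to89.B11SectG (BlockNorm HasMaj hasMaj_comp_exp)
open Literature.MathematicalPhysics.QuantumFieldTheory.Balaban1983to89.B11AxialTransport190 (abs_le_loc_ofBlocks loc_ofBlocks_le)
open Literature.MathematicalPhysics.QuantumFieldTheory.Balaban1983to89.T4EtaRateCoeffDefect (pull pull_apply fibre mem_fibre)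
open Literature.MathematicalPhysics.QuantumFieldTheory.Balaban1983to89.B5Prop11Plancherel (Tor fine unitVec)
open Literature.MathematicalPhysics.QuantumFieldTheory.Balaban1983to89.B5Block118 (bpt)
open Literature.MathematicalPhysics.QuantumFieldTheory.Balaban1983to89.B5SettingP12Real (latticeSettingP12R)
open Literature.MathematicalPhysics.QuantumFieldTheory.Balaban1983to89.B5SiteBridgeP12 (MP)
open Literature.MathematicalPhysics.QuantumFieldTheory.King1986.Torus (blockOf tdistT tdistT_nonneg tdistT_symm tdistT_self tdistT_triangle tdistT_sub_unitVec_le)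
open Literature.MathematicalPhysics.QuantumFieldTheory.Balaban1983to89.B6UnitTorusCarrier (unitTorusGeo unitTorusGeo_dist_nonneg triangle254_unitTorusGeo
  rowSum_unitTorusGeo card_fibre_blockOf)
open Summit.QuantumFields.YangMills.BalabanUVNodes.N15.DefectKernel (pr_bpt)
open Summit.QuantumFields.YangMills.BalabanUVNodes.N15.VectorPiece (blkFine blkFine_apply kingPr kingPrV kingPr_val kingPrV_eq blkFine_comp_kingPrV lineWeight
  lineWeight_nonneg tdistT_le_one_of_lineWeight_ne_zero abs_lineWeight_pair_sub_le)

variable {d : ℕ}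

/-! ## §36 Block-majorant transfer through Bałaban's averaging operators `Q^s`, `Q`, `Q*` and their two-grid differences -/

section AveragingTransfer

variable {L : ℕ} (M : Fin (d + 1) → ℕ) [∀ μ, NeZero (M μ)] (k n : ℕ) [NeZero n] {F₁ : Type} [AddCommGroup F₁] [Module ℝ F₁]

/-- **THE BLOCK AVERAGE IS DOMINATED BY THE BLOCK SUP**: `|(Q^s f)(y, κ)| ≤ loc_y f` for fine 1-forms blocked by King's unit blocks. [folklore] -/
theorem abs_qsOp_apply_le (f : Tor (fine n M) × Fin (d + 1) → ℝ) (b : Tor M × Fin (d + 1)) :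
    |qsOp M n f b| ≤ (BlockNorm.ofBlocks (unitTorusGeo L k M) (fun i : Tor (fine n M) × Fin (d + 1) => blockOf n M i.1)).loc b.1 f := by
  have hn : (0 : ℝ) < (n : ℝ) ^ (d + 1) := pow_pos (by exact_mod_cast Nat.pos_of_ne_zero (NeZero.ne n)) _
  set ℓ := (BlockNorm.ofBlocks (unitTorusGeo L k M) (fun i : Tor (fine n M) × Fin (d + 1) => blockOf n M i.1)).loc b.1 f with hℓ
  rw [qsOp_apply, abs_mul, abs_inv, abs_of_pos hn]
  calc ((n : ℝ) ^ (d + 1))⁻¹ * |∑ x ∈ fibre (blockOf n M) b.1, f (x, b.2)|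
      ≤ ((n : ℝ) ^ (d + 1))⁻¹ * ∑ x ∈ fibre (blockOf n M) b.1, ℓ := by
        gcongr
        exact (abs_sum_le_sum_abs _ _).trans (sum_le_sum fun x hx =>
          abs_le_loc_ofBlocks (g := unitTorusGeo L k M) (fun i : Tor (fine n M) × Fin (d + 1) => blockOf n M i.1) f (x' := (x, b.2))
            ((mem_fibre _ _ _).mp hx))
    _ = ℓ := by rw [sum_const, card_fibre_blockOf, nsmul_eq_mul, Nat.cast_pow, ← mul_assoc, inv_mul_cancel₀ hn.ne', one_mul]

/-- **`Q` KEEPS EXPONENTIAL BLOCK MAJORANTS UP TO `e^{ρ}`**: if `T` has majorant `B·e^{−ρd}` into fine 1-forms blocked by King's unit blocks, then `Q∘T` (`Q = qvRe M n` =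
`Q^s∘ρ(a_κ(n))`, Bałaban's (1.18)) has majorant `B·e^{ρ}·e^{−ρd}` into unit-lattice 1-forms blocked by their site. [cite: Balaban1984PropagatorsI, (1.18) p.20] -/
theorem hasMaj_qvRe_comp {b₁ : BlockNorm (unitTorusGeo L k M) F₁} {T : F₁ →ₗ[ℝ] (Tor (fine n M) × Fin (d + 1) → ℝ)} {B ρ : ℝ} (hB : 0 ≤ B) (hρ : 0 ≤ ρ)
    (h : HasMaj b₁ (BlockNorm.ofBlocks (unitTorusGeo L k M) (fun i : Tor (fine n M) × Fin (d + 1) => blockOf n M i.1)) T (fun y y' => B * Real.exp (-(ρ * tdistT M y y')))) :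
    HasMaj b₁ (BlockNorm.ofBlocks (unitTorusGeo L k M) (fun b : Tor M × Fin (d + 1) => b.1)) (qvRe M n ∘ₗ T)
      (fun y y' => B * Real.exp ρ * Real.exp (-(ρ * tdistT M y y'))) := by
  intro y' μ hμ y
  refine loc_ofBlocks_le (g := unitTorusGeo L k M) (fun b : Tor M × Fin (d + 1) => b.1) _
    (mul_nonneg (mul_nonneg (mul_nonneg hB (Real.exp_nonneg _)) (Real.exp_nonneg _)) (b₁.loc_nonneg y' μ)) fun b hb => ?_
  rw [LinearMap.comp_apply, qvRe_apply]
  have hA := hasMaj_sA_comp M k n hB hρ b.2 (NeZero.ne n) le_rfl h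
  calc |qsOp M n (symbOp M n (sA M n b.2 n) (T μ)) b|
      ≤ (BlockNorm.ofBlocks (unitTorusGeo L k M) (fun i : Tor (fine n M) × Fin (d + 1) => blockOf n M i.1)).loc b.1 ((symbOp M n (sA M n b.2 n) ∘ₗ T) μ) :=
        abs_qsOp_apply_le M k n _ b
    _ ≤ B * Real.exp ρ * Real.exp (-(ρ * tdistT M y y')) * b₁.loc y' μ := by rw [hb]; exact hA y' μ hμ y

/-- **`Q*` KEEPS EXPONENTIAL BLOCK MAJORANTS UP TO `e^{ρ}`**: if `S` has majorant `B·e^{−ρd}` into unit-lattice 1-forms blocked by their site, then `Q*∘S` (`Q* = qvAdjRe M n`,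
the line-weight stencil with weights in `[0,1]` summing to `1` and supported on the two blocks `B(x)`, `B(x) − e_κ`) has majorant `B·e^{ρ}·e^{−ρd}` into fine 1-forms blocked by
King's unit blocks. [cite: Balaban1984PropagatorsI, (1.18) p.20 (the stencil of Q*)] -/
theorem hasMaj_qvAdjRe_comp {b₁ : BlockNorm (unitTorusGeo L k M) F₁} {S : F₁ →ₗ[ℝ] (Tor M × Fin (d + 1) → ℝ)} {B ρ : ℝ} (hB : 0 ≤ B) (hρ : 0 ≤ ρ)
    (h : HasMaj b₁ (BlockNorm.ofBlocks (unitTorusGeo L k M) (fun b : Tor M × Fin (d + 1) => b.1)) S (fun y y' => B * Real.exp (-(ρ * tdistT M y y')))) :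
    HasMaj b₁ (BlockNorm.ofBlocks (unitTorusGeo L k M) (fun i : Tor (fine n M) × Fin (d + 1) => blockOf n M i.1)) (qvAdjRe M n ∘ₗ S)
      (fun y y' => B * Real.exp ρ * Real.exp (-(ρ * tdistT M y y'))) := by
  intro y' μ hμ y
  have hK0 : 0 ≤ B * Real.exp ρ * Real.exp (-(ρ * tdistT M y y')) := mul_nonneg (mul_nonneg hB (Real.exp_nonneg _)) (Real.exp_nonneg _)
  refine loc_ofBlocks_le (g := unitTorusGeo L k M) (fun i : Tor (fine n M) × Fin (d + 1) => blockOf n M i.1) _ (mul_nonneg hK0 (b₁.loc_nonneg y' μ)) fun i hi => ?_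
  obtain ⟨x, κ⟩ := i
  simp only at hi
  rw [LinearMap.comp_apply, qvAdjRe_apply]
  -- each stencil point `z` lies within one block of `B(x) = y`
  have hz : ∀ z : Tor M, lineWeight n M κ x z * |S μ (z, κ)| ≤ lineWeight n M κ x z * (B * Real.exp ρ * Real.exp (-(ρ * tdistT M y y')) * b₁.loc y' μ) := by
    intro z
    by_cases hθ : lineWeight n M κ x z = 0
    · rw [hθ, zero_mul, zero_mul]
    refine mul_le_mul_of_nonneg_left ?_ (lineWeight_nonneg n M κ x z)
    have hd1 : tdistT M z y ≤ 1 := by rw [← hi]; exact tdistT_le_one_of_lineWeight_ne_zero n M κ x hθ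
    have hv : |S μ (z, κ)| ≤ B * Real.exp (-(ρ * tdistT M z y')) * b₁.loc y' μ :=
      (abs_le_loc_ofBlocks (g := unitTorusGeo L k M) (fun b : Tor M × Fin (d + 1) => b.1) (S μ) (x' := (z, κ)) rfl).trans (h y' μ hμ z)
    refine hv.trans (mul_le_mul_of_nonneg_right ?_ (b₁.loc_nonneg y' μ))
    rw [mul_assoc, ← Real.exp_add]
    refine mul_le_mul_of_nonneg_left (Real.exp_le_exp.mpr ?_) hB
    have ht := tdistT_triangle M y z y'
    rw [tdistT_symm M y z] at ht
    nlinarith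
  calc |∑ z : Tor M, lineWeight n M κ x z * S μ (z, κ)| ≤ ∑ z : Tor M, |lineWeight n M κ x z * S μ (z, κ)| := abs_sum_le_sum_abs _ _
    _ = ∑ z : Tor M, lineWeight n M κ x z * |S μ (z, κ)| := sum_congr rfl fun z _ => by rw [abs_mul, abs_of_nonneg (lineWeight_nonneg n M κ x z)]
    _ ≤ ∑ z : Tor M, lineWeight n M κ x z * (B * Real.exp ρ * Real.exp (-(ρ * tdistT M y y')) * b₁.loc y' μ) := sum_le_sum fun z _ => hz z
    _ = B * Real.exp ρ * Real.exp (-(ρ * tdistT M y y')) * b₁.loc y' μ := by rw [← sum_mul, sum_lineWeight, one_mul]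

variable (m : ℕ) [NeZero L]

/-- ★ **THE TWO-GRID CONSISTENCY OF `Q*` IN BLOCK-MAJORANT FORM**: if `S` has majorant `B·e^{−ρd}` into unit-lattice 1-forms blocked by their site, then `(Q′* − P∘Q*)∘S`
(`Q′* = qvAdjRe M (L^m·L^k)`, `Q* = qvAdjRe M (L^k)`, `P = pull kingPrV` King's prolongation) has majorant `(2e^{ρ}∕L^k)·B·e^{−ρd}`: both stencils weight the same two unit blocks
`y`, `y − e_κ` with weights differing by `≤ 1∕L^k` (part 20 `abs_lineWeight_pair_sub_le`). [cite: Balaban1984PropagatorsI, (1.18) p.20; King1986, p.664 (the pairing)] -/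
theorem hasMaj_qvAdjRe_sub_pull_comp {b₁ : BlockNorm (unitTorusGeo L k M) F₁} {S : F₁ →ₗ[ℝ] (Tor M × Fin (d + 1) → ℝ)} {B ρ : ℝ} (hB : 0 ≤ B) (hρ : 0 ≤ ρ)
    (h : HasMaj b₁ (BlockNorm.ofBlocks (unitTorusGeo L k M) (fun b : Tor M × Fin (d + 1) => b.1)) S (fun y y' => B * Real.exp (-(ρ * tdistT M y y')))) :
    HasMaj b₁ (BlockNorm.ofBlocks (unitTorusGeo L k M) (fun i : Tor (fine (L ^ m * L ^ k) M) × Fin (d + 1) => blockOf (L ^ m * L ^ k) M i.1))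
      ((qvAdjRe M (L ^ m * L ^ k) - pull (kingPrV L k m M) ∘ₗ qvAdjRe M (L ^ k)) ∘ₗ S)
      (fun y y' => 2 * Real.exp ρ / (L : ℝ) ^ k * B * Real.exp (-(ρ * tdistT M y y'))) := by
  classical
  have hL : (0 : ℝ) < L := by exact_mod_cast Nat.pos_of_ne_zero (NeZero.ne L)
  have hLk : (0 : ℝ) < (L : ℝ) ^ k := pow_pos hL k
  have he1 : 1 ≤ Real.exp ρ := Real.one_le_exp hρ
  intro y' μ hμ y
  have hK0 : 0 ≤ 2 * Real.exp ρ / (L : ℝ) ^ k * B * Real.exp (-(ρ * tdistT M y y')) :=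
    mul_nonneg (mul_nonneg (div_nonneg (mul_nonneg zero_le_two (Real.exp_nonneg _)) hLk.le) hB) (Real.exp_nonneg _)
  refine loc_ofBlocks_le (g := unitTorusGeo L k M) (fun i : Tor (fine (L ^ m * L ^ k) M) × Fin (d + 1) => blockOf (L ^ m * L ^ k) M i.1) _
    (mul_nonneg hK0 (b₁.loc_nonneg y' μ)) fun i hi => ?_
  obtain ⟨x', κ⟩ := i
  simp only at hi
  obtain ⟨a', hx'⟩ := exists_eq_bpt_blockOf M (L ^ m * L ^ k) x'
  rw [hi] at hx'
  let ah : Fin (d + 1) → Fin (L ^ k) := fun ν => ⟨(a' ν : ℕ) / L ^ m, Nat.div_lt_of_lt_mul (a' ν).isLt⟩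
  have hpr : kingPr L k m M x' = bpt (L ^ k) M y ah := by
    rw [hx']; exact pr_bpt (L ^ m) (L ^ k) M (kingPr L k m M) (kingPr_val L k m M) y a' ah fun _ => rfl
  rw [LinearMap.comp_apply, LinearMap.sub_apply, LinearMap.comp_apply, Pi.sub_apply, pull_apply, kingPrV_eq, qvAdjRe_apply, qvAdjRe_apply]
  simp only
  rw [hpr, ← sum_sub_distrib]
  -- the sizes of `Sμ` on the two blocks `y`, `y − e_κ`
  have hv : ∀ z : Tor M, tdistT M z y ≤ 1 → |S μ (z, κ)| ≤ B * Real.exp ρ * Real.exp (-(ρ * tdistT M y y')) * b₁.loc y' μ := by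
    intro z hd1
    have h0 : |S μ (z, κ)| ≤ B * Real.exp (-(ρ * tdistT M z y')) * b₁.loc y' μ :=
      (abs_le_loc_ofBlocks (g := unitTorusGeo L k M) (fun b : Tor M × Fin (d + 1) => b.1) (S μ) (x' := (z, κ)) rfl).trans (h y' μ hμ z)
    refine h0.trans (mul_le_mul_of_nonneg_right ?_ (b₁.loc_nonneg y' μ))
    rw [mul_assoc, ← Real.exp_add]
    refine mul_le_mul_of_nonneg_left (Real.exp_le_exp.mpr ?_) hB
    have ht := tdistT_triangle M y z y'
    rw [tdistT_symm M y z] at ht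
    nlinarith
  have hw : ∀ z : Tor M, |lineWeight (L ^ m * L ^ k) M κ x' z * S μ (z, κ) - lineWeight (L ^ k) M κ (bpt (L ^ k) M y ah) z * S μ (z, κ)| ≤
      ((if z = y then 1 else 0) + (if z + unitVec M κ = y then 1 else 0)) / ((L ^ k : ℕ) : ℝ) * (B * Real.exp ρ * Real.exp (-(ρ * tdistT M y y')) * b₁.loc y' μ) := by
    intro z
    rw [← sub_mul, abs_mul]
    have hθ : |lineWeight (L ^ m * L ^ k) M κ x' z - lineWeight (L ^ k) M κ (bpt (L ^ k) M y ah) z| ≤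
        ((if z = y then 1 else 0) + (if z + unitVec M κ = y then 1 else 0)) / ((L ^ k : ℕ) : ℝ) := by
      rw [hx']
      exact abs_lineWeight_pair_sub_le (L ^ k) M (L ^ m) y z a' ah (fun _ => rfl) κ
    by_cases hz : z = y ∨ z + unitVec M κ = y
    · have hd1 : tdistT M z y ≤ 1 := by
        rcases hz with hz | hz
        · rw [hz, tdistT_self]; exact zero_le_one
        · rw [eq_sub_of_add_eq hz, tdistT_symm]
          exact tdistT_sub_unitVec_le M y κ
      exact mul_le_mul hθ (hv z hd1) (abs_nonneg _) (by positivity)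
    · push Not at hz
      rw [if_neg hz.1, if_neg hz.2] at hθ
      have h0 : |lineWeight (L ^ m * L ^ k) M κ x' z - lineWeight (L ^ k) M κ (bpt (L ^ k) M y ah) z| = 0 :=
        le_antisymm (by simpa using hθ) (abs_nonneg _)
      rw [h0, zero_mul, if_neg hz.1, if_neg hz.2]
      simp
  refine (abs_sum_le_sum_abs _ _).trans ((sum_le_sum fun z _ => hw z).trans ?_)
  rw [← sum_mul, ← sum_div, sum_add_distrib, sum_ite_eq' univ y, if_pos (mem_univ y)]
  have h2 : ∑ z : Tor M, (if z + unitVec M κ = y then (1 : ℝ) else 0) = 1 := by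
    rw [show (fun z : Tor M => if z + unitVec M κ = y then (1 : ℝ) else 0) = fun z => if z = y - unitVec M κ then 1 else 0 from
      funext fun z => by simp only [eq_sub_iff_add_eq], sum_ite_eq' univ, if_pos (mem_univ _)]
  rw [h2, Nat.cast_pow]
  exact le_of_eq (by ring)

/-- ★ **THE TWO-GRID CONSISTENCY OF `Q` IN BLOCK-MAJORANT FORM**: if for every direction `κ` the coarse difference `η∇_κS = (n⁻¹ρ(sD_κ n))∘S` (`n = L^k`) has majorant `B·e^{−ρd}` into
coarse 1-forms blocked by King's unit blocks, then `(Q′∘P − Q)∘S` (`Q′ = qvRe M (L^m·L^k)`, `Q = qvRe M (L^k)`) has majorant `B·e^{ρ}·e^{−ρd}` into unit-lattice 1-forms: by part 37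
`(Q′Pu − Qu)(y,κ) = Q′^s[ρ′(a′_κ(L^m) − 1)·P(ρ(a_κ(L^k))u)](y,κ)`, `a′_κ(L^m) − 1 = L^{−m}Σ_{j<L^m}(s_κ^j − 1)` (part 44) and each `(ρ′(s_κ^j)P − P)(ρ(a_κ)S)` is dominated by
`ρ(a_κ)(η∇_κS)` (part 44 `hasMaj_shiftPull_sub`). [cite: Balaban1984PropagatorsI, (1.18) p.20; King1986, Prop. 3.9 p.664 (η-rate shape)] -/
theorem hasMaj_qvRe_pull_sub_comp {b₁ : BlockNorm (unitTorusGeo L k M) F₁} {S : F₁ →ₗ[ℝ] (Tor (fine (L ^ k) M) × Fin (d + 1) → ℝ)} {B ρ : ℝ} (hB : 0 ≤ B) (hρ : 0 ≤ ρ)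
    (h : ∀ κ : Fin (d + 1), HasMaj b₁ (BlockNorm.ofBlocks (unitTorusGeo L k M) (blkFine L k M))
      ((((L ^ k : ℕ) : ℝ)⁻¹ • symbOp M (L ^ k) (sD M (L ^ k) κ ((L ^ k : ℕ) : ℝ))) ∘ₗ S) (fun y y' => B * Real.exp (-(ρ * tdistT M y y')))) :
    HasMaj b₁ (BlockNorm.ofBlocks (unitTorusGeo L k M) (fun b : Tor M × Fin (d + 1) => b.1))
      ((qvRe M (L ^ m * L ^ k) ∘ₗ pull (kingPrV L k m M) - qvRe M (L ^ k)) ∘ₗ S)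
      (fun y y' => B * Real.exp ρ * Real.exp (-(ρ * tdistT M y y'))) := by
  classical
  have hL0 : 0 < L := Nat.pos_of_ne_zero (NeZero.ne L)
  have hR0 : L ^ m ≠ 0 := by positivity
  have hR' : (0 : ℝ) < ((L ^ m : ℕ) : ℝ) := by exact_mod_cast Nat.pos_of_ne_zero hR0
  have hK0 : ∀ y y' : Tor M, 0 ≤ B * Real.exp ρ * Real.exp (-(ρ * tdistT M y y')) := fun y y' => mul_nonneg (mul_nonneg hB (Real.exp_nonneg _)) (Real.exp_nonneg _)
  -- per direction `κ`: the operator `E_κ := ρ′(a′_κ(L^m) − 1)∘P∘ρ(a_κ(L^k))∘S` and its majorant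
  have hE : ∀ κ : Fin (d + 1), HasMaj b₁ (BlockNorm.ofBlocks (unitTorusGeo L k M) (fun i : Tor (fine (L ^ m * L ^ k) M) × Fin (d + 1) => blockOf (L ^ m * L ^ k) M i.1))
      (symbOp M (L ^ m * L ^ k) (sA M (L ^ m * L ^ k) κ (L ^ m) - 1) ∘ₗ (pull (kingPrV L k m M) ∘ₗ (symbOp M (L ^ k) (sA M (L ^ k) κ (L ^ k)) ∘ₗ S)))
      (fun y y' => B * Real.exp ρ * Real.exp (-(ρ * tdistT M y y'))) := by
    intro κ
    -- `η∇_κ(ρ(a_κ)S) = ρ(a_κ)(η∇_κS)` has majorant `B e^{ρ} e^{−ρd}`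
    have hAS : HasMaj b₁ (BlockNorm.ofBlocks (unitTorusGeo L k M) (blkFine L k M))
        ((((L ^ k : ℕ) : ℝ)⁻¹ • symbOp M (L ^ k) (sD M (L ^ k) κ ((L ^ k : ℕ) : ℝ))) ∘ₗ (symbOp M (L ^ k) (sA M (L ^ k) κ (L ^ k)) ∘ₗ S))
        (fun y y' => B * Real.exp ρ * Real.exp (-(ρ * tdistT M y y'))) := by
      have h1 := hasMaj_sA_comp M k (L ^ k) (b₁ := b₁) hB hρ κ (R := L ^ k) (by positivity) le_rfl (h κ)
      refine h1.congr fun μ => ?_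
      simp only [LinearMap.comp_apply, LinearMap.smul_apply, map_smul]
      rw [← Module.End.mul_apply, ← map_mul, mul_comm, map_mul, Module.End.mul_apply]
    have hJ : ∀ j ∈ range (L ^ m), HasMaj b₁ (BlockNorm.ofBlocks (unitTorusGeo L k M) (fun i : Tor (fine (L ^ m * L ^ k) M) × Fin (d + 1) => blockOf (L ^ m * L ^ k) M i.1))
        ((symbOp M (L ^ m * L ^ k) (sT M (L ^ m * L ^ k) κ ^ j) ∘ₗ pull (kingPrV L k m M) - pull (kingPrV L k m M)) ∘ₗ (symbOp M (L ^ k) (sA M (L ^ k) κ (L ^ k)) ∘ₗ S))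
        (fun y y' => B * Real.exp ρ * Real.exp (-(ρ * tdistT M y y'))) :=
      fun j hj => hasMaj_shiftPull_sub M k m hK0 κ (mem_range.mp hj).le hAS
    have hsumJ := hasMaj_finsum (g := unitTorusGeo L k M) (b₁ := b₁)
      (b₂ := BlockNorm.ofBlocks (unitTorusGeo L k M) (fun i : Tor (fine (L ^ m * L ^ k) M) × Fin (d + 1) => blockOf (L ^ m * L ^ k) M i.1)) (range (L ^ m))
      (fun j => (symbOp M (L ^ m * L ^ k) (sT M (L ^ m * L ^ k) κ ^ j) ∘ₗ pull (kingPrV L k m M) - pull (kingPrV L k m M)) ∘ₗ (symbOp M (L ^ k) (sA M (L ^ k) κ (L ^ k)) ∘ₗ S))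
      (fun _ y y' => B * Real.exp ρ * Real.exp (-(ρ * tdistT M y y'))) hJ
    refine ((hasMaj_smul_ofBlocks (g := unitTorusGeo L k M) (fun i : Tor (fine (L ^ m * L ^ k) M) × Fin (d + 1) => blockOf (L ^ m * L ^ k) M i.1)
      (fun y y' => sum_nonneg fun _ _ => hK0 y y') (((L ^ m : ℕ) : ℝ)⁻¹) hsumJ).congr fun μ => ?_).mono fun y y' => le_of_eq ?_
    · rw [sA_sub_one M (L ^ m * L ^ k) κ hR0]
      simp only [LinearMap.smul_apply, LinearMap.sum_apply, LinearMap.comp_apply, LinearMap.sub_apply, map_smul, map_sum, map_sub, map_one,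
        Module.End.one_apply]
    · rw [sum_const, card_range, nsmul_eq_mul, abs_of_nonneg (inv_nonneg.mpr hR'.le), ← mul_assoc, inv_mul_cancel₀ hR'.ne', one_mul]
  intro y' μ hμ y
  refine loc_ofBlocks_le (g := unitTorusGeo L k M) (fun b : Tor M × Fin (d + 1) => b.1) _ (mul_nonneg (hK0 y y') (b₁.loc_nonneg y' μ)) fun b hb => ?_
  rw [LinearMap.comp_apply, LinearMap.sub_apply, LinearMap.comp_apply, Pi.sub_apply, qvRe_pull_sub_apply]
  calc |qsOp M (L ^ m * L ^ k) (symbOp M (L ^ m * L ^ k) (sA M (L ^ m * L ^ k) b.2 (L ^ m) - 1)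
          (pull (kingPrV L k m M) (symbOp M (L ^ k) (sA M (L ^ k) b.2 (L ^ k)) (S μ)))) b|
      ≤ (BlockNorm.ofBlocks (unitTorusGeo L k M) (fun i : Tor (fine (L ^ m * L ^ k) M) × Fin (d + 1) => blockOf (L ^ m * L ^ k) M i.1)).loc b.1
          ((symbOp M (L ^ m * L ^ k) (sA M (L ^ m * L ^ k) b.2 (L ^ m) - 1) ∘ₗ (pull (kingPrV L k m M) ∘ₗ (symbOp M (L ^ k) (sA M (L ^ k) b.2 (L ^ k)) ∘ₗ S))) μ) :=
        abs_qsOp_apply_le M k (L ^ m * L ^ k) _ b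
    _ ≤ B * Real.exp ρ * Real.exp (-(ρ * tdistT M y y')) * b₁.loc y' μ := by rw [hb]; exact hE b.2 y' μ hμ y

end AveragingTransfer

/-! ## §37 ★★ THE AVERAGING TERM `G′∘(Q′*Q′P̂₂ − PQ*Q)∘G` IS `O(η)` IN BLOCK-MAJORANT CURRENCY -/

section AveragingDefect

variable {L : ℕ} [NeZero L] (M : Fin (d + 1) → ℕ) [∀ μ, NeZero (M μ)] (k m : ℕ) (a : ℝ)

/-- the three-piece telescoping of the averaging consistency operator, sandwiched: `G′Q′*Q′(P̂₂ − P)G + G′Q′*(Q′P − Q)G + G′(Q′* − PQ*)QG = G′(Q′*Q′P̂₂ − PQ*Q)G`. [folklore] -/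
theorem cQ_split_apply (μ : Tor (fine (L ^ k) M) × Fin (d + 1) → ℝ) :
    (gOp M (L ^ m * L ^ k) a ∘ₗ (qvAdjRe M (L ^ m * L ^ k) ∘ₗ (qvRe M (L ^ m * L ^ k) ∘ₗ
        ((symbOp M (L ^ m * L ^ k) (sSm M (L ^ m * L ^ k) (L ^ m)) ∘ₗ pull (kingPrV L k m M) - pull (kingPrV L k m M)) ∘ₗ gOp M (L ^ k) a)))) μ
    + (gOp M (L ^ m * L ^ k) a ∘ₗ (qvAdjRe M (L ^ m * L ^ k) ∘ₗ ((qvRe M (L ^ m * L ^ k) ∘ₗ pull (kingPrV L k m M) - qvRe M (L ^ k)) ∘ₗ gOp M (L ^ k) a))) μ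
    + (gOp M (L ^ m * L ^ k) a ∘ₗ ((qvAdjRe M (L ^ m * L ^ k) - pull (kingPrV L k m M) ∘ₗ qvAdjRe M (L ^ k)) ∘ₗ (qvRe M (L ^ k) ∘ₗ gOp M (L ^ k) a))) μ
    = (gOp M (L ^ m * L ^ k) a ∘ₗ ((qvAdjRe M (L ^ m * L ^ k) ∘ₗ qvRe M (L ^ m * L ^ k) ∘ₗ symbOp M (L ^ m * L ^ k) (sSm M (L ^ m * L ^ k) (L ^ m)) ∘ₗ pull (kingPrV L k m M)
        - pull (kingPrV L k m M) ∘ₗ qvAdjRe M (L ^ k) ∘ₗ qvRe M (L ^ k)) ∘ₗ gOp M (L ^ k) a)) μ := by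
  simp only [LinearMap.comp_apply, LinearMap.sub_apply, map_sub]
  abel

/-- **CORE ESTIMATE (explicit constants)** behind `hasMaj_averagingDefect`: for ONE torus `M`, given the (1.110)–(1.114) packages of the coarse (`HP1`) and the fine (`HP2`) member,
`G′∘(Q′*∘Q′∘P̂₂ − P∘Q*∘Q)∘G` has the block majorant `C₀·[((d+1)·2C₀e^{(2d+1)δ₀} + C₀)e^{2δ₀} + 2e^{2δ₀}C₀]·latticeConst(d+1, δ₀∕2)·(L^k)⁻¹·e^{−(δ₀∕2)|y−y′|_T}`.
[cite: Balaban1984PropagatorsI, Prop. 1.2 (1.110) p.35, (1.18) p.20] -/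
theorem hasMaj_averagingDefect_core {C₀ δ₀ : ℝ} {Cα Cε : ℝ → ℝ} {Cαε : ℝ → ℝ → ℝ} (hC₀ : 0 < C₀) (hδ₀ : 0 < δ₀)
    (HP1 : B5.Ineq110_114 (latticeSettingP12R (L ^ k) M a k) C₀ Cα Cε Cαε δ₀)
    (HP2 : B5.Ineq110_114 (latticeSettingP12R (L ^ m * L ^ k) M a (m + k)) C₀ Cα Cε Cαε δ₀) :
    HasMaj (BlockNorm.ofBlocks (unitTorusGeo L k M) (blkFine L k M)) (BlockNorm.ofBlocks (unitTorusGeo L k M) (fun i : Tor (fine (L ^ m * L ^ k) M) × Fin (d + 1) => blockOf (L ^ m * L ^ k) M i.1))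
      (gOp M (L ^ m * L ^ k) a ∘ₗ ((qvAdjRe M (L ^ m * L ^ k) ∘ₗ qvRe M (L ^ m * L ^ k) ∘ₗ symbOp M (L ^ m * L ^ k) (sSm M (L ^ m * L ^ k) (L ^ m)) ∘ₗ pull (kingPrV L k m M)
        - pull (kingPrV L k m M) ∘ₗ qvAdjRe M (L ^ k) ∘ₗ qvRe M (L ^ k)) ∘ₗ gOp M (L ^ k) a))
      (fun y y' => (C₀ * ((((d : ℝ) + 1) * (2 * C₀ * Real.exp δ₀ ^ (2 * d + 1)) + C₀) * (Real.exp δ₀ * Real.exp δ₀) + 2 * Real.exp δ₀ * (C₀ * Real.exp δ₀)) *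
          B4Sect5Proof.latticeConst (d + 1) (δ₀ / 2)) * ((L ^ k : ℕ) : ℝ)⁻¹ * Real.exp (-(δ₀ / 2 * tdistT M y y'))) := by
  classical
  have hσ0 : 0 < δ₀ / 2 := by linarith
  have hcR0 : 0 ≤ B4Sect5Proof.latticeConst (d + 1) (δ₀ / 2) := B4Sect5Proof.latticeConst_nonneg (d + 1) hσ0.le
  have hL0 : 0 < L := Nat.pos_of_ne_zero (NeZero.ne L)
  have hLr : (0 : ℝ) < L := by exact_mod_cast hL0
  have hn1 : 1 ≤ L ^ k := Nat.one_le_pow _ _ hL0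
  have hn'1 : 1 ≤ L ^ m * L ^ k := Nat.one_le_iff_ne_zero.mpr (Nat.mul_ne_zero (by positivity) (by positivity))
  have hn0 : (0 : ℝ) < ((L ^ k : ℕ) : ℝ) := by exact_mod_cast hn1
  have hLk : ((L : ℝ) ^ k) = ((L ^ k : ℕ) : ℝ) := by push_cast; ring
  have he0 : 0 ≤ Real.exp δ₀ := Real.exp_nonneg _
  set bC := BlockNorm.ofBlocks (unitTorusGeo L k M) (blkFine L k M) with hbC
  set bU := BlockNorm.ofBlocks (unitTorusGeo L k M) (fun b : Tor M × Fin (d + 1) => b.1) with hbU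
  set bF := BlockNorm.ofBlocks (unitTorusGeo L k M) (fun i : Tor (fine (L ^ m * L ^ k) M) × Fin (d + 1) => blockOf (L ^ m * L ^ k) M i.1) with hbF
  -- (0) the fine member's entry «GJ»: `G′` has majorant `C₀e^{−δ₀d}` on `bF`
  have hG' : HasMaj bF bF (gOp M (L ^ m * L ^ k) a) (fun y y' => C₀ * Real.exp (-(δ₀ * tdistT M y y'))) :=
    hasMaj_gOp_of_ineq M k (L ^ m * L ^ k) a hn'1 HP2 hC₀.le
  -- the left composition with `G′`
  have hcompG' : ∀ {T : (Tor (fine (L ^ k) M) × Fin (d + 1) → ℝ) →ₗ[ℝ] (Tor (fine (L ^ m * L ^ k) M) × Fin (d + 1) → ℝ)} {A : ℝ}, 0 ≤ A →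
      HasMaj bC bF T (fun y y' => A * Real.exp (-(δ₀ * tdistT M y y'))) →
      HasMaj bC bF (gOp M (L ^ m * L ^ k) a ∘ₗ T) (fun y y' => bF.κ * C₀ * A * B4Sect5Proof.latticeConst (d + 1) (δ₀ / 2) * Real.exp (-(δ₀ / 2 * tdistT M y y'))) :=
    fun hA hT => hasMaj_comp_exp (b₁ := bC) (b₂ := bF) (b₃ := bF) (triangle254_unitTorusGeo L k M) (unitTorusGeo_dist_nonneg L k M) (rowSum_unitTorusGeo L k M hσ0)
      hC₀.le hA hσ0.le (by linarith) (by linarith) hG' hT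
  -- (1) the output-swap piece `Q′*Q′(P̂₂ − P)G`
  have h1a := hasMaj_outputSwap_core (L := L) M k m a hC₀ hδ₀ HP1
  have hA1 : 0 ≤ ((d : ℝ) + 1) * (2 * C₀ * Real.exp δ₀ ^ (2 * d + 1)) * ((L ^ k : ℕ) : ℝ)⁻¹ :=
    mul_nonneg (mul_nonneg (by positivity) (mul_nonneg (mul_nonneg zero_le_two hC₀.le) (pow_nonneg he0 _))) (inv_nonneg.mpr hn0.le)
  have h1b := hasMaj_qvRe_comp M k (L ^ m * L ^ k) (b₁ := bC) hA1 hδ₀.le h1a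
  have h1c := hasMaj_qvAdjRe_comp M k (L ^ m * L ^ k) (b₁ := bC) (mul_nonneg hA1 he0) hδ₀.le h1b
  have h1 := hcompG' (mul_nonneg (mul_nonneg hA1 he0) he0) h1c
  -- (2) the line-filter piece `Q′*(Q′P − Q)G`, from the coarse member's entry «∇GJ»
  have hgrad : ∀ κ : Fin (d + 1), HasMaj bC (BlockNorm.ofBlocks (unitTorusGeo L k M) (blkFine L k M))
      ((((L ^ k : ℕ) : ℝ)⁻¹ • symbOp M (L ^ k) (sD M (L ^ k) κ ((L ^ k : ℕ) : ℝ))) ∘ₗ gOp M (L ^ k) a)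
      (fun y y' => ((L ^ k : ℕ) : ℝ)⁻¹ * C₀ * Real.exp (-(δ₀ * tdistT M y y'))) := by
    intro κ
    have h0 := hasMaj_grad_of_ineq (L := L) M k (L ^ k) a hn1 HP1 hC₀.le κ
    rw [LinearMap.smul_comp]
    refine (hasMaj_smul_ofBlocks (g := unitTorusGeo L k M) (blkFine L k M) (fun y y' => mul_nonneg hC₀.le (Real.exp_nonneg _)) (((L ^ k : ℕ) : ℝ)⁻¹) h0).mono
      fun y y' => le_of_eq ?_
    rw [abs_of_nonneg (inv_nonneg.mpr hn0.le), mul_assoc]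
  have hA2 : 0 ≤ ((L ^ k : ℕ) : ℝ)⁻¹ * C₀ := mul_nonneg (inv_nonneg.mpr hn0.le) hC₀.le
  have h2a := hasMaj_qvRe_pull_sub_comp M k m (b₁ := bC) hA2 hδ₀.le hgrad
  have h2b := hasMaj_qvAdjRe_comp M k (L ^ m * L ^ k) (b₁ := bC) (mul_nonneg hA2 he0) hδ₀.le h2a
  have h2 := hcompG' (mul_nonneg (mul_nonneg hA2 he0) he0) h2b
  -- (3) the stencil piece `(Q′* − PQ*)QG`, from the coarse member's entry «GJ»
  have hG : HasMaj bC (BlockNorm.ofBlocks (unitTorusGeo L k M) (fun i : Tor (fine (L ^ k) M) × Fin (d + 1) => blockOf (L ^ k) M i.1)) (gOp M (L ^ k) a)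
      (fun y y' => C₀ * Real.exp (-(δ₀ * tdistT M y y'))) :=
    hasMaj_gOp_of_ineq M k (L ^ k) a hn1 HP1 hC₀.le
  have h3a := hasMaj_qvRe_comp M k (L ^ k) (b₁ := bC) hC₀.le hδ₀.le hG
  have h3b := hasMaj_qvAdjRe_sub_pull_comp M k m (b₁ := bC) (mul_nonneg hC₀.le he0) hδ₀.le h3a
  have hA3 : 0 ≤ 2 * Real.exp δ₀ / (L : ℝ) ^ k * (C₀ * Real.exp δ₀) := mul_nonneg (div_nonneg (mul_nonneg zero_le_two he0) (pow_nonneg hLr.le _)) (mul_nonneg hC₀.le he0)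
  have h3 := hcompG' hA3 h3b
  -- (4) sum of the three pieces and the target operator
  have hκ : bF.κ = 1 := rfl
  refine ((h1.add h2).add h3 |>.congr fun μ => ?_).mono fun y y' => le_of_eq ?_
  · rw [LinearMap.add_apply, LinearMap.add_apply]
    exact cQ_split_apply M k m a μ
  · rw [hκ, hLk]
    field_simp

/-- ★★ **THE AVERAGING TERM OF THE TWO-GRID CONSISTENCY OPERATOR OF `Δ_a`, SANDWICHED BETWEEN BAŁABAN's PROPAGATORS, IS `O(η)` IN BLOCK-MAJORANT CURRENCY, HYPOTHESIS-FREE.**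
For odd `L > 1`, `a > 0` there are `δ, C > 0` such that for every torus exponent `m_T`, coarse scale `k ≥ 1` (`η = L^{−k}`) and refinement `m` (`η′ = η∕L^m`), with `G = Δ_a⁻¹` on
`T_η` (`gOp M (L^k) a`), `G′` on `T_{η′}`, King's prolongation `P = pull kingPrV`, `P̂₂ = ρ′(Π_νa_ν(L^m)²)∘P`, Bałaban's averaging `Q = qvRe` (1.18) and its adjoint `Q* = qvAdjRe`
at both finenesses: `G′∘(Q′*∘Q′∘P̂₂ − P∘Q*∘Q)∘G` has the block majorant `C·(L^k)⁻¹·e^{−δ|y−y′|_T}` from coarse 1-forms blocked by King's unit blocks to fine 1-forms blocked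
likewise — the `a·C_Q` term of `idef P P̂₂ G′ G = −G′(Δ′_aP̂₂ − PΔ_a)G` (plan §7.2) up to the scalar `a`.  MECHANISM: §36–§37 header. [cite: Balaban1984PropagatorsI, Prop. 1.2 (1.110) p.35, (1.18) p.20; King1986, Prop. 3.9 p.664 (η-rate shape)] -/
theorem hasMaj_averagingDefect (hL : Odd L ∧ 1 < L) {a : ℝ} (ha : 0 < a) :
    ∃ δ C : ℝ, 0 < δ ∧ 0 < C ∧ ∀ (mT k m : ℕ) (hk : 1 ≤ k),
      HasMaj (BlockNorm.ofBlocks (unitTorusGeo L k (MP (paramsOf d L mT k hL))) (blkFine L k (MP (paramsOf d L mT k hL))))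
        (BlockNorm.ofBlocks (unitTorusGeo L k (MP (paramsOf d L mT k hL)))
          (fun i : Tor (fine (L ^ m * L ^ k) (MP (paramsOf d L mT k hL))) × Fin (d + 1) => blockOf (L ^ m * L ^ k) (MP (paramsOf d L mT k hL)) i.1))
        (gOp (MP (paramsOf d L mT k hL)) (L ^ m * L ^ k) a ∘ₗ
          ((qvAdjRe (MP (paramsOf d L mT k hL)) (L ^ m * L ^ k) ∘ₗ qvRe (MP (paramsOf d L mT k hL)) (L ^ m * L ^ k) ∘ₗ
              symbOp (MP (paramsOf d L mT k hL)) (L ^ m * L ^ k) (sSm (MP (paramsOf d L mT k hL)) (L ^ m * L ^ k) (L ^ m)) ∘ₗ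
                pull (kingPrV L k m (MP (paramsOf d L mT k hL)))
            - pull (kingPrV L k m (MP (paramsOf d L mT k hL))) ∘ₗ qvAdjRe (MP (paramsOf d L mT k hL)) (L ^ k) ∘ₗ qvRe (MP (paramsOf d L mT k hL)) (L ^ k)) ∘ₗ
            gOp (MP (paramsOf d L mT k hL)) (L ^ k) a))
        (fun y y' => C * ((L ^ k : ℕ) : ℝ)⁻¹ * Real.exp (-(δ * tdistT (MP (paramsOf d L mT k hL)) y y'))) := by
  obtain ⟨δ₀, C₀, Cα, Cε, Cαε, hδ₀, hC₀, HP⟩ := ineq110_114_pair (d := d) hL ha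
  have hcR0 : 0 ≤ B4Sect5Proof.latticeConst (d + 1) (δ₀ / 2) := B4Sect5Proof.latticeConst_nonneg (d + 1) (by linarith)
  refine ⟨δ₀ / 2, C₀ * ((((d : ℝ) + 1) * (2 * C₀ * Real.exp δ₀ ^ (2 * d + 1)) + C₀) * (Real.exp δ₀ * Real.exp δ₀) + 2 * Real.exp δ₀ * (C₀ * Real.exp δ₀)) *
      B4Sect5Proof.latticeConst (d + 1) (δ₀ / 2) + 1, by linarith, by positivity, fun mT k m hk => ?_⟩
  refine (hasMaj_averagingDefect_core (MP (paramsOf d L mT k hL)) k m a hC₀ hδ₀ (HP mT k m hk).1 (HP mT k m hk).2).mono fun y y' => ?_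
  have hn0 : (0 : ℝ) < ((L ^ k : ℕ) : ℝ) := by exact_mod_cast Nat.one_le_pow _ _ (Nat.pos_of_ne_zero (NeZero.ne L))
  exact mul_le_mul_of_nonneg_right (mul_le_mul_of_nonneg_right (by linarith) (inv_nonneg.mpr hn0.le)) (Real.exp_nonneg _)

end AveragingDefect

end Summit.QuantumFields.YangMills.BalabanUVNodes.N15.TwoGrid
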